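import Summits.ABC.IUTFork.Joshi.TensorNormsBidual
import Mathlib.Analysis.Normed.Lp.ProdLp
import Mathlib.Analysis.Normed.Group.Ultra
import HarnessLib

/-!
# Joshi's §7.6 (arXiv:2401.13508v4, Thm 7.6.2.2 (2) «projective = injective over a p-adic field»): the claim-Prop
# `TensorNorm.ProjEqInjClaim` is FALSE AS TYPED at `E = ℚ_p` — print's (2) is about ULTRAMETRIC Banach spaces

Proof-only companion (abc-iut cell, branch E, rung LADDER-ABC:A2.E; seat abc-iut-E-t44, T-44 test/discharge seat, RQ7-with-teeth on
abc-iut-E-t14's `Joshi/TensorNorms.lean`) — sequel of `Joshi/TensorNormsBidualLimits.lean` (p431661; the two facts about the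
`ℓ¹`-plane used here are re-derived privately so that this file does not wait for that module's build). TAKES NO SIDE on [IUTchIII] Cor. 3.12, on
Joshi's claims (unrefereed preprint, bib `Joshi2024ATS3`) or on Mochizuki's report on them. Nothing printed by Joshi is denied here:
[J-III] Thm 7.6.2.2 (2) (PDF p. 62 l. 8–10) — «if `E` is a p-adic field, then projective tensor product and the injective tensor
products coincide» ([van der Put–van Tiel 1967]) — is a statement about Banach spaces in the NON-ARCHIMEDEAN sense (ultrametric
norms, the standing convention of its sources). OUR typing `TensorNorm.ProjEqInjClaim p E` quantifies over ALL Mathlib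
`NormedSpace E (V i)`, ultrametric or not (abc-iut-found's typing flag, STATUS 06:50:16Z), and that typed sentence is refutable:

* `injectiveNorm_tprod_le_prod_bidual` (any field): `injectiveNorm (⨂ₜ m) ≤ ∏ ‖ι (m i)‖` — the injective norm of a pure tensor is
  bounded by the BIDUAL norms of the factors (each ratio `‖g_i (m_i)‖ / ‖g_i‖ ≤ ‖ι (m_i)‖`);
* `norm_le_norm_tprod_single` (any field, one-element index): `‖m 0‖ ≤ ‖⨂ₜ[𝕜] i : Fin 1, m i‖` (evaluate the identity through
  Mathlib's `norm_eval_le_projectiveSeminorm`);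
* `not_projEqInjClaim_padic`: with `ι = Fin 1` and the complete, finite-dimensional, NON-ultrametric `ℚ_p`-space
  `W = (ℚ_p², ℓ¹)` of `TensorNormsBidualLimits` (`‖ι (1,1)‖ ≤ 1 < 2 = ‖(1,1)‖`): `injectiveNorm (⨂ₜ (1,1)) ≤ 1 < 2 ≤ ‖⨂ₜ (1,1)‖`,
  so `¬ ProjEqInjClaim.{0,0,0} p ℚ_[p]` for every prime `p`.

CONSEQUENCE for the record (RQ7 defect E-T44-D2, repair is one binder): every theorem consuming `ProjEqInjClaim p ℚ_[p]` as typed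
(`injectiveNorm_tprod_of_claims`) is vacuous; the faithful typing adds `[∀ i, IsUltrametricDist (V i)]` (WEAKER = print's
setting; Joshi's `B_E`, `E′_w` are ultrametric), after which (2) is van der Put–van Tiel's theorem (not in Mathlib; FOUNDATIONS §G).
Whether `CrossNormClaim` (Thm 7.6.2.2 (3)) is also refutable as typed is NOT claimed here (the `ℓ¹`-plane is not a counterexample to
the Σ-projective cross-norm). Classical functional analysis only ([folklore]); no side taken; typed ≠ proved.
-/

noncomputable section

open scoped TensorProduct
open PiTensorProduct NormedSpace

namespace Summit.ABC.IUTFork.Joshi.TensorNorm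

section General

variable {ι : Type*} [Fintype ι] {𝕜 : Type*} [NontriviallyNormedField 𝕜]
  {V : ι → Type*} [∀ i, SeminormedAddCommGroup (V i)] [∀ i, NormedSpace 𝕜 (V i)]

omit [Fintype ι] in
/-- Each dual ratio of a vector is bounded by its bidual norm: `‖g m‖ / ‖g‖ ≤ ‖ι m‖`. [folklore] -/
theorem norm_apply_div_le_bidual {i : ι} (m : V i) (g : V i →L[𝕜] 𝕜) :
    ‖g m‖ / ‖g‖ ≤ ‖inclusionInDoubleDual 𝕜 (V i) m‖ := by
  refine div_le_of_le_mul₀ (norm_nonneg g) (norm_nonneg (inclusionInDoubleDual 𝕜 (V i) m)) ?_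
  rw [← dual_def 𝕜 (V i) m g]
  exact (inclusionInDoubleDual 𝕜 (V i) m).le_opNorm g

/-- **The injective norm of a pure tensor is bounded by the product of the BIDUAL norms of its factors** (any field):
`injectiveNorm (⨂ₜ m) ≤ ∏ ‖ι (m i)‖`. [folklore] -/
theorem injectiveNorm_tprod_le_prod_bidual (m : Π i, V i) :
    injectiveNorm (⨂ₜ[𝕜] i, m i) ≤ ∏ i, ‖inclusionInDoubleDual 𝕜 (V i) (m i)‖ := by
  refine Real.iSup_le (fun g => ?_)
    (Finset.prod_nonneg fun i _ => norm_nonneg (inclusionInDoubleDual 𝕜 (V i) (m i)))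
  rw [dualEval_tprod, norm_prod, ← Finset.prod_div_distrib]
  exact Finset.prod_le_prod (fun i _ => div_nonneg (norm_nonneg _) (norm_nonneg _))
    fun i _ => norm_apply_div_le_bidual (m i) (g i)

end General

section Single

variable {𝕜 : Type*} [NontriviallyNormedField 𝕜] {W : Type*} [SeminormedAddCommGroup W] [NormedSpace 𝕜 W]

/-- **One factor: the projective norm dominates the factor's norm**, `‖m 0‖ ≤ ‖⨂ₜ[𝕜] i : Fin 1, m i‖` (evaluate the identity
of `W`, as a multilinear map on the one-element family, through `norm_eval_le_projectiveSeminorm`). [folklore] -/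
theorem norm_le_norm_tprod_single (m : Fin 1 → W) : ‖m 0‖ ≤ ‖(⨂ₜ[𝕜] i, m i : ⨂[𝕜] _ : Fin 1, W)‖ := by
  let f : ContinuousMultilinearMap 𝕜 (fun _ : Fin 1 => W) W :=
    ContinuousMultilinearMap.ofSubsingleton 𝕜 W W (0 : Fin 1) (ContinuousLinearMap.id 𝕜 W)
  have h1 : lift f.toMultilinearMap (⨂ₜ[𝕜] i, m i) = m 0 := by
    rw [lift.tprod]
    rfl
  have h2 : ‖f‖ ≤ 1 := by
    rw [ContinuousMultilinearMap.norm_ofSubsingleton]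
    exact ContinuousLinearMap.norm_id_le
  calc ‖m 0‖ = ‖lift f.toMultilinearMap (⨂ₜ[𝕜] i, m i)‖ := by rw [h1]
    _ ≤ ‖f‖ * ‖(⨂ₜ[𝕜] i, m i : ⨂[𝕜] _ : Fin 1, W)‖ := norm_eval_le_projectiveSeminorm f _
    _ ≤ 1 * ‖(⨂ₜ[𝕜] i, m i : ⨂[𝕜] _ : Fin 1, W)‖ := mul_le_mul_of_nonneg_right h2 (norm_nonneg _)
    _ = _ := one_mul _

end Single

section Padic

variable (p : ℕ) [Fact p.Prime]

/-- `‖(1, 1)‖_{ℓ¹} = 2` (as in `TensorNormsBidualLimits.norm_l1Diag`). [folklore] -/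
private theorem norm_l1Diag' :
    ‖(WithLp.toLp 1 ((1 : ℚ_[p]), (1 : ℚ_[p])) : WithLp 1 (ℚ_[p] × ℚ_[p]))‖ = 2 := by
  rw [WithLp.prod_norm_eq_of_L1]
  simp only [WithLp.toLp_fst, WithLp.toLp_snd, norm_one]
  norm_num

/-- `‖ι (1, 1)‖ ≤ 1` on `(ℚ_p², ℓ¹)` (as in `TensorNormsBidualLimits.norm_inclusionInDoubleDual_l1Diag_le`: ultrametric
inequality in `ℚ_p`). [folklore] -/
private theorem norm_inclusionInDoubleDual_l1Diag_le' :
    ‖inclusionInDoubleDual ℚ_[p] (WithLp 1 (ℚ_[p] × ℚ_[p]))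
      (WithLp.toLp 1 ((1 : ℚ_[p]), (1 : ℚ_[p])) : WithLp 1 (ℚ_[p] × ℚ_[p]))‖ ≤ 1 := by
  refine ContinuousLinearMap.opNorm_le_bound _ zero_le_one fun g => ?_
  have hsplit : (WithLp.toLp 1 ((1 : ℚ_[p]), (1 : ℚ_[p])) : WithLp 1 (ℚ_[p] × ℚ_[p])) =
      WithLp.toLp 1 ((1 : ℚ_[p]), (0 : ℚ_[p])) + WithLp.toLp 1 ((0 : ℚ_[p]), (1 : ℚ_[p])) := by
    rw [← WithLp.toLp_add, Prod.mk_add_mk, add_zero, zero_add]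
  have h1 : ‖(WithLp.toLp 1 ((1 : ℚ_[p]), (0 : ℚ_[p])) : WithLp 1 (ℚ_[p] × ℚ_[p]))‖ = 1 := by
    rw [WithLp.prod_norm_eq_of_L1]; simp only [WithLp.toLp_fst, WithLp.toLp_snd, norm_one, norm_zero]; norm_num
  have h2 : ‖(WithLp.toLp 1 ((0 : ℚ_[p]), (1 : ℚ_[p])) : WithLp 1 (ℚ_[p] × ℚ_[p]))‖ = 1 := by
    rw [WithLp.prod_norm_eq_of_L1]; simp only [WithLp.toLp_fst, WithLp.toLp_snd, norm_one, norm_zero]; norm_num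
  rw [dual_def, one_mul, hsplit, map_add]
  refine (IsUltrametricDist.norm_add_le_max _ _).trans (max_le ?_ ?_)
  · simpa [h1] using g.le_opNorm (WithLp.toLp 1 ((1 : ℚ_[p]), (0 : ℚ_[p])))
  · simpa [h2] using g.le_opNorm (WithLp.toLp 1 ((0 : ℚ_[p]), (1 : ℚ_[p])))

/-- **Thm 7.6.2.2 (2) AS TYPED is false at `E = ℚ_p`**: `¬ TensorNorm.ProjEqInjClaim p ℚ_[p]` (one-element family of the complete
non-ultrametric plane `(ℚ_p², ℓ¹)`, pure tensor of `(1,1)`: injective norm `≤ 1`, projective norm `≥ 2`). Print's (2) concerns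
ultrametric Banach spaces and is not touched. [folklore] -/
theorem not_projEqInjClaim_padic : ¬ ProjEqInjClaim.{0, 0, 0} p ℚ_[p] := fun h => by
  let W : Type := WithLp 1 (ℚ_[p] × ℚ_[p])
  let m : Fin 1 → W := fun _ => WithLp.toLp 1 ((1 : ℚ_[p]), (1 : ℚ_[p]))
  have hc : ∀ _ : Fin 1, CompleteSpace W := fun _ => FiniteDimensional.complete ℚ_[p] W
  have heq := h inferInstance (Fin 1) (fun _ => W) hc (⨂ₜ[ℚ_[p]] i, m i)
  have hlow : (2 : ℝ) ≤ ‖(⨂ₜ[ℚ_[p]] i, m i : ⨂[ℚ_[p]] _ : Fin 1, W)‖ := by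
    have := norm_le_norm_tprod_single (𝕜 := ℚ_[p]) m
    rwa [show ‖m 0‖ = 2 from norm_l1Diag' p] at this
  have hup : injectiveNorm (⨂ₜ[ℚ_[p]] i, m i : ⨂[ℚ_[p]] _ : Fin 1, W) ≤ 1 := by
    refine (injectiveNorm_tprod_le_prod_bidual m).trans ?_
    rw [Fin.prod_univ_one]
    exact norm_inclusionInDoubleDual_l1Diag_le' p
  rw [heq] at hup
  linarith

end Padic

end Summit.ABC.IUTFork.Joshi.TensorNorm

end
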